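/-
Copyright (c) 2026 the pub-hodgecm-mathlib formalisation cell (harness21).  Prover seat hodgecm-mathlib-K2Liu-p10 (g3), Track B «K2-LIT»,
#184♮ = hLiu418 = `stmt-HodgeConjecture-24832`; LEAD F0P6-plan (g13) RULING «M-157j» (1): G5-a sub-organ (α) (the middle cell of the
constant term), file α2d-1 — THE FRAME CRITERION `w₀ (Λ x · u) w₀ ∈ P_Δ ⟺ x ∈ B, (xX)₁₁ = 0` FOR `n = 2`, AND THE `GL₂` BOREL BOOKKEEPING.
THEOREMS ONLY (no `def`, no `instance`, no named-fact hypothesis, no `sorry`).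
-/
import Mathlib.LinearAlgebra.Projectivization.Basic
import Summits.HodgeConjecture.HodgeConjecture.Theorems.K2LiuSiegelMiddleCellSortedPattern       -- α2b: sorted pattern, `w₀`
import Summits.HodgeConjecture.HodgeConjecture.Theorems.K2LiuSiegelRationalLeviDecomposition     -- α2c: `Λ`, `frame_levi_apply`
import HarnessLib

/-!
# Crux `HLiu418`, ROAD Φ, (α) file α2d-1: THE MIDDLE CELL FOR `n = 2` — THE FRAME CRITERION `w₀ · (Λ x · u) · w₀ ∈ P_Δ(𝔸)` AND THE BOREL
# `B = M_Δ ∩ w₀⁻¹ P_Δ w₀ ≅ {g ∈ GL₂ : g₁₀ = 0}`, `B(K)∖GL₂(K) ≅ ℙ¹(K)`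

Cell `hodgecm-mathlib`, crux item hLiu418 = `stmt-HodgeConjecture-24832` (helper lane, count-neutral).  For the doubled unitary group of a
`2`-dimensional hermitian space (`e : Fin N × Fin M ≃ Fin 2`) the middle of `P_Δ(L⁺)∖H(L⁺)` is the single double coset `P_Δ · w₀ · P_Δ`
(α2b `exists_siegel_mul_reflStd_mul_siegel`, `w₀ = ι(1, g₀ ⊗ 1)`, `g₀ = diag(1 − 2·![0,1]∘e)`), and its right `N_Δ(L⁺)`-orbits are read off the
frame criterion of ★ B2a `reflConj_leviFrame_mul_unip_siegel_iff` at the corner idempotent `E = diag(0, 1)`: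
* §1 (`GL₂` over a field `K`): `row_ne_zero`, **`mul_inv_apply_one_zero_eq_zero_iff`** (`(g' g⁻¹)₁₀ = 0 ⟺ ∃ c ∈ Kˣ, c • g₁ = g'₁`, rows `1`),
  **`mk_row_eq_iff`** (`⟺` equal classes `[g'₁] = [g₁]` in `ℙ(K²)`), `inv_apply_one_zero`, `exists_gl_row_eq`, **`exists_rowSection`** (a section
  `ℙ(K²) → GL₂(K)` of `g ↦ [g₁]`) — the right `B(K)`-cosets of `GL₂(K)` are the points of `ℙ¹(K)`;
* §2 (`Fin 2` block algebra over a commutative ring): the three corner conditions of ★ B2a at `E = diag(0,1)` as matrix ENTRIES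
  (`E a (1−E) = 0 ⟺ a₁₀ = 0`, `(1−E) d E = 0 ⟺ d₀₁ = 0`, `E Z E = 0 ⟺ Z₁₁ = 0`), `fromBlocks_eq_of_toBlocks₂₁_eq_zero`, `det_neg_two_smul_diag01`;
* §3 (the doubled group, BY VALUE `Λ ∕ hΛ` in ★ `exists_leviHom`'s shape and `g₀ ∕ hg₀` in α2b `exists_reflStd`'s shape): `algebraMap_pattern_std`,
  `exists_gramR_eq_diagonal`, `reflStd_mul_self` ∕ `reflStd_inv` (`w₀² = 1`), `det_corner_reflStd_mul_siegel` + `not_isSiegelDelta_reflStd_mul_siegel`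
  (`w₀ q`, `q ∈ P_Δ`, is a MIDDLE element: corner `−2·diag(0,1)·a_q`, determinant `0`, non-zero),
  **`isSiegelDelta_reflStd_conj_levi_unip_iff`**: `w₀ (Λ x · u) w₀ ∈ P_Δ ⟺ (x₁₀ = 0 ∧ (x♯)₀₁ = 0) ∧ (x · X_u)₁₁ = 0`, `x♯ = T⁻¹(x̄⁻¹)ᵀT`
  (α2c `frame_levi_apply`, ★ `frame_iotaGG_signInvolution`, ★ `mem_unipDelta_iff_conj`), and its rational forms
  **`isSiegelDelta_reflStd_conj_levi_map_unip_iff`** (`⟺ g₁₀ = 0 ∧ (ĝ X_u)₁₁ = 0` — the `♯`-condition is automatic for upper-triangular `g`, `T` diagonal)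
  and `isSiegelDelta_reflStd_conj_levi_map_iff` (`u = 1`: `w₀ Λĝ w₀ ∈ P_Δ ⟺ g ∈ B(L)`).
Consumer: α2d-2 `K2LiuConstantTermMiddleCellOrbits` (REST `= ⨆_{p ∈ ℙ¹(L)} O([w₀ Λ(γ p)^])`, stabilisers), α3 `K2LiuConstantTermMiddleCellGL2`.
Sources: [GelbartPiatetskishapiroRallis1987, Part A §§1–2]; [KudlaRallis1994, §§1–2]; [MoeglinWaldspurger1995, II.1.7].
HONEST LABEL.  Helper lemmas, count-neutral; `HC_CM` is proved only modulo the 7 printed citations (2 remaining named inputs: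
hLiu418 = `stmt-HodgeConjecture-24832`, h413 = `stmt-HodgeConjecture-24833`) until rung 0 closes.
-/

set_option autoImplicit false
set_option linter.dupNamespace false -- the mandated namespace repeats `HodgeConjecture.HodgeConjecture`

noncomputable section

open scoped Matrix
open NumberField IsDedekindDomain Set Function
open Literature.NumberTheory.Automorphic Literature.NumberTheory.Automorphic.UnitaryGroup
open Literature.NumberTheory.GelbartRogawski1991 Literature.NumberTheory.GelbartRogawski1991.GRConstruction
open Literature.NumberTheory.GelbartRogawski1991.AdaptedBlocks
open Literature.NumberTheory.K2Lit.SiegelDoubled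
open UnitaryDualPair

namespace Summit.HodgeConjecture.HodgeConjecture.Cruxes.HLiu418.K2LiuSiegelMiddleCellLeviCriterion

open K2LiuSiegelDoubledBlkUnitary K2LiuSiegelDoubledRationalPoints K2LiuSiegelDoubledLeviMatrix K2LiuSiegelDoubledLeviAlgebra
  K2LiuSiegelDoubledRationalFrames K2LiuSiegelLeviConjUnipDeltaChar K2LiuSiegelRationalLeviDecomposition
  K2LiuSiegelBruhatCells K2LiuSiegelBruhatMiddleCell K2LiuSiegelBruhatMiddleCellDelta K2LiuSiegelBruhatMiddleCellExhaustion
  K2LiuSiegelMiddleCellSortedPattern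

/-! ## §1 `GL₂` over a field: the Borel `{g₁₀ = 0}` and the rows `1` up to scalars -/

section GL2

variable {K : Type*} [Field K]

/-- a row of an invertible matrix is non-zero. [folklore] -/
theorem row_ne_zero (g : GL (Fin 2) K) (i : Fin 2) : (g : Matrix (Fin 2) (Fin 2) K) i ≠ 0 := by
  intro h
  have hdet : (g : Matrix (Fin 2) (Fin 2) K).det = 0 := Matrix.det_eq_zero_of_row_eq_zero i fun j => by rw [h]; rfl
  exact not_isUnit_zero (hdet ▸ Matrix.isUnits_det_units g)

/-- **`(g' g⁻¹)₁₀ = 0 ⟺` the rows `1` of `g` and `g'` are proportional** (`(g'g⁻¹)₁ = g'₁ ᵥ* g⁻¹` and `g₁ ᵥ* g⁻¹ = e₁`). [folklore] -/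
theorem mul_inv_apply_one_zero_eq_zero_iff (g g' : GL (Fin 2) K) :
    ((g' * g⁻¹ : GL (Fin 2) K) : Matrix (Fin 2) (Fin 2) K) 1 0 = 0 ↔
      ∃ c : Kˣ, c • (g : Matrix (Fin 2) (Fin 2) K) 1 = (g' : Matrix (Fin 2) (Fin 2) K) 1 := by
  have hgg : (g' : Matrix (Fin 2) (Fin 2) K) = ((g' * g⁻¹ : GL (Fin 2) K) : Matrix (Fin 2) (Fin 2) K) * (g : Matrix (Fin 2) (Fin 2) K) := by
    rw [Units.val_mul, Matrix.mul_assoc, Matrix.coe_units_inv, Matrix.nonsing_inv_mul _ (Matrix.isUnits_det_units g), Matrix.mul_one]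
  constructor
  · intro h
    have hdet : IsUnit ((g' * g⁻¹ : GL (Fin 2) K) : Matrix (Fin 2) (Fin 2) K).det := Matrix.isUnits_det_units _
    rw [Matrix.det_fin_two, h, mul_zero, sub_zero] at hdet
    have h11 : ((g' * g⁻¹ : GL (Fin 2) K) : Matrix (Fin 2) (Fin 2) K) 1 1 ≠ 0 := fun h0 => not_isUnit_zero (by rw [h0, mul_zero] at hdet; exact hdet)
    refine ⟨Units.mk0 _ h11, ?_⟩
    funext j
    rw [hgg, Matrix.mul_apply, Fin.sum_univ_two, h, zero_mul, zero_add, Pi.smul_apply, Units.smul_mk0, smul_eq_mul]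
  · rintro ⟨c, hc⟩
    rw [Units.val_mul, Matrix.mul_apply, Fin.sum_univ_two]
    have h0 : (g' : Matrix (Fin 2) (Fin 2) K) 1 0 = c * (g : Matrix (Fin 2) (Fin 2) K) 1 0 := by
      rw [← hc, Pi.smul_apply, Units.smul_def, smul_eq_mul]
    have h1 : (g' : Matrix (Fin 2) (Fin 2) K) 1 1 = c * (g : Matrix (Fin 2) (Fin 2) K) 1 1 := by
      rw [← hc, Pi.smul_apply, Units.smul_def, smul_eq_mul]
    have hI : ((g : Matrix (Fin 2) (Fin 2) K) * ((g⁻¹ : GL (Fin 2) K) : Matrix (Fin 2) (Fin 2) K)) 1 0 = 0 := by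
      rw [← Units.val_mul, mul_inv_cancel, Units.val_one, Matrix.one_apply_ne (by decide)]
    rw [Matrix.mul_apply, Fin.sum_univ_two] at hI
    rw [h0, h1, mul_assoc, mul_assoc, ← mul_add, hI, mul_zero]

/-- **rows `1` in `ℙ(K²)`**: `[g'₁] = [g₁] ⟺ (g' g⁻¹)₁₀ = 0` — the right `B(K)`-cosets of `GL₂(K)` (`B` = upper triangular) are the points of `ℙ¹(K)`.
[cite: KudlaRallis1994, §2] -/
theorem mk_row_eq_iff (g g' : GL (Fin 2) K) :
    Projectivization.mk K ((g' : Matrix (Fin 2) (Fin 2) K) 1) (row_ne_zero g' 1) = Projectivization.mk K ((g : Matrix (Fin 2) (Fin 2) K) 1) (row_ne_zero g 1) ↔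
      ((g' * g⁻¹ : GL (Fin 2) K) : Matrix (Fin 2) (Fin 2) K) 1 0 = 0 := by
  rw [Projectivization.mk_eq_mk_iff, mul_inv_apply_one_zero_eq_zero_iff]

/-- the inverse of an upper-triangular `2 × 2` matrix is upper triangular: `g₁₀ = 0 ⟹ (g⁻¹)₁₀ = 0`. [folklore] -/
theorem inv_apply_one_zero {g : GL (Fin 2) K} (h : (g : Matrix (Fin 2) (Fin 2) K) 1 0 = 0) : ((g⁻¹ : GL (Fin 2) K) : Matrix (Fin 2) (Fin 2) K) 1 0 = 0 := by
  rw [Matrix.coe_units_inv, Matrix.inv_def, Matrix.adjugate_fin_two, Matrix.smul_apply, smul_eq_mul]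
  simp [h]

/-- every non-zero `v ∈ K²` is the row `1` of some `g ∈ GL₂(K)`. [folklore] -/
theorem exists_gl_row_eq {v : Fin 2 → K} (hv : v ≠ 0) : ∃ g : GL (Fin 2) K, (g : Matrix (Fin 2) (Fin 2) K) 1 = v := by
  by_cases h0 : v 0 = 0
  · have h1 : v 1 ≠ 0 := fun h1 => hv (by funext j; fin_cases j <;> assumption)
    refine ⟨Matrix.GeneralLinearGroup.mkOfDetNeZero !![1, 0; v 0, v 1] (by rw [Matrix.det_fin_two_of]; simpa using h1), ?_⟩
    funext j
    rw [Matrix.GeneralLinearGroup.val_mkOfDetNeZero]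
    fin_cases j <;> simp
  · refine ⟨Matrix.GeneralLinearGroup.mkOfDetNeZero !![0, 1; v 0, v 1] (by rw [Matrix.det_fin_two_of]; simpa using h0), ?_⟩
    funext j
    rw [Matrix.GeneralLinearGroup.val_mkOfDetNeZero]
    fin_cases j <;> simp

/-- **a row section `ℙ(K²) → GL₂(K)`**: `γ` with `[ (γ p)₁ ] = p` for every `p`. [folklore] -/
theorem exists_rowSection : ∃ γ : Projectivization K (Fin 2 → K) → GL (Fin 2) K,
    ∀ p, Projectivization.mk K ((γ p : Matrix (Fin 2) (Fin 2) K) 1) (row_ne_zero (γ p) 1) = p := by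
  choose γ hγ using fun p : Projectivization K (Fin 2 → K) => exists_gl_row_eq (Projectivization.rep_nonzero p)
  refine ⟨γ, fun p => ?_⟩
  simp_rw [hγ p]
  exact Projectivization.mk_rep p

end GL2

/-! ## §2 The corner conditions of ★ B2a at `E = diag(0, 1)` as matrix entries -/

section Corner

variable {R : Type*} [CommRing R]

/-- `diag(0,1) · a · (1 − diag(0,1)) = 0 ⟺ a₁₀ = 0`. [folklore] -/
theorem diag01_mul_mul_one_sub_diag01_eq_zero_iff (a : Matrix (Fin 2) (Fin 2) R) :
    Matrix.diagonal (![0, 1] : Fin 2 → R) * a * (1 - Matrix.diagonal (![0, 1] : Fin 2 → R)) = 0 ↔ a 1 0 = 0 := by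
  constructor
  · intro h
    have h10 := congrFun (congrFun h 1) 0
    simpa [Matrix.mul_apply, Fin.sum_univ_two, Matrix.one_apply] using h10
  · intro h
    ext i j
    fin_cases i <;> fin_cases j <;> simp [Matrix.mul_apply, Fin.sum_univ_two, Matrix.one_apply, h]

/-- `(1 − diag(0,1)) · d · diag(0,1) = 0 ⟺ d₀₁ = 0`. [folklore] -/
theorem one_sub_diag01_mul_mul_diag01_eq_zero_iff (d : Matrix (Fin 2) (Fin 2) R) :
    (1 - Matrix.diagonal (![0, 1] : Fin 2 → R)) * d * Matrix.diagonal (![0, 1] : Fin 2 → R) = 0 ↔ d 0 1 = 0 := by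
  constructor
  · intro h
    have h01 := congrFun (congrFun h 0) 1
    simpa [Matrix.mul_apply, Fin.sum_univ_two, Matrix.one_apply] using h01
  · intro h
    ext i j
    fin_cases i <;> fin_cases j <;> simp [Matrix.mul_apply, Fin.sum_univ_two, Matrix.one_apply, h]

/-- `diag(0,1) · Z · diag(0,1) = 0 ⟺ Z₁₁ = 0`. [folklore] -/
theorem diag01_mul_mul_diag01_eq_zero_iff (Z : Matrix (Fin 2) (Fin 2) R) :
    Matrix.diagonal (![0, 1] : Fin 2 → R) * Z * Matrix.diagonal (![0, 1] : Fin 2 → R) = 0 ↔ Z 1 1 = 0 := by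
  constructor
  · intro h
    have h11 := congrFun (congrFun h 1) 1
    simpa [Matrix.mul_apply, Fin.sum_univ_two] using h11
  · intro h
    ext i j
    fin_cases i <;> fin_cases j <;> simp [Matrix.mul_apply, Fin.sum_univ_two, h]

/-- a block matrix with vanishing lower-left block is the Siegel frame of its other three blocks. [folklore] -/
theorem fromBlocks_eq_of_toBlocks₂₁_eq_zero {m : Type*} [Fintype m] [DecidableEq m] {F : Matrix (m ⊕ m) (m ⊕ m) R} (h : F.toBlocks₂₁ = 0) :
    F = Matrix.fromBlocks F.toBlocks₁₁ F.toBlocks₁₂ 0 F.toBlocks₂₂ := by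
  rw [← h, Matrix.fromBlocks_toBlocks]

/-- `det(−2·diag(0,1)) = 0`: the corner of a middle representative is singular. [folklore] -/
theorem det_neg_two_smul_diag01 : (-((2 : R) • Matrix.diagonal (![0, 1] : Fin 2 → R))).det = 0 := by
  rw [Matrix.det_neg, Matrix.det_smul, Matrix.det_diagonal, Fin.prod_univ_two]
  simp

end Corner

/-! ## §3 The doubled group for `n = 2`: the frame criterion for `w₀ (Λ x · u) w₀ ∈ P_Δ` -/

section Doubled

variable (L : Type) [Field L] [NumberField L] [IsCMField L]
variable {N M : ℕ} (e : Fin N × Fin M ≃ Fin 2)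
  (dV : Fin N → L) (hdV : ∀ i, IsCMField.complexConj L (dV i) = dV i)
  (dW : Fin M → L) (hdW : ∀ i, IsCMField.complexConj L (dW i) = dW i)

omit [IsCMField L] in
/-- the adelic pattern of `![0, 1]` is `![0, 1]`. [folklore] -/
theorem algebraMap_pattern_std : (fun i : Fin 2 => algebraMap L (AdeleRing (𝓞 L) L) ((![0, 1] : Fin 2 → L) i)) = (![0, 1] : Fin 2 → AdeleRing (𝓞 L) L) := by
  funext i
  fin_cases i
  · exact map_zero _
  · exact map_one _

/-- the Gram matrix `T = reindex e (diag dV ⊗ diag dW)` is diagonal. [folklore] -/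
theorem exists_gramR_eq_diagonal : ∃ t : Fin 2 → Fp L, gramR L e dV hdV dW hdW = Matrix.diagonal t := by
  refine ⟨(fun mn : Fin N × Fin M => (⟨dV mn.1, (IsCMField.complexConj_eq_self_iff (K := L) (dV mn.1)).1 (hdV mn.1)⟩ : Fp L) *
    (⟨dW mn.2, (IsCMField.complexConj_eq_self_iff (K := L) (dW mn.2)).1 (hdW mn.2)⟩ : Fp L)) ∘ e.symm, ?_⟩
  unfold gramR gram realDiagonal
  rw [Matrix.diagonal_kronecker_diagonal, Matrix.reindex_apply, Matrix.submatrix_diagonal_equiv]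

variable {g₀ : UnitaryGroup.rationalPair (Fp L) L (IsCMField.complexConj L) N M (Matrix.diagonal dV) (Matrix.diagonal dW)}
  (hg₀ : ((g₀ : GL (Fin N × Fin M) L) : Matrix (Fin N × Fin M) (Fin N × Fin M) L) = Matrix.diagonal (fun k => 1 - 2 * (![0, 1] : Fin 2 → L) (e k)))

include hg₀ in
/-- `w₀² = 1` for `w₀ = ι(1, g₀ ⊗ 1)`. [cite: GelbartPiatetskishapiroRallis1987, Part A §1] -/
theorem reflStd_mul_self :
    iotaGG L e dV hdV dW hdW (1, UnitaryGroup.rationalPairToAdelic (Fp L) L (IsCMField.complexConj L) N M (Matrix.diagonal dV) (Matrix.diagonal dW) g₀) *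
      iotaGG L e dV hdV dW hdW (1, UnitaryGroup.rationalPairToAdelic (Fp L) L (IsCMField.complexConj L) N M (Matrix.diagonal dV) (Matrix.diagonal dW) g₀) = 1 :=
  iotaGG_one_mul_self L e dV hdV dW hdW (by rw [← map_mul, mul_self_of_coe_eq_signDiagonal L e dV dW (pattern_std L) hg₀, map_one])

include hg₀ in
/-- `w₀⁻¹ = w₀`. [cite: GelbartPiatetskishapiroRallis1987, Part A §1] -/
theorem reflStd_inv :
    (iotaGG L e dV hdV dW hdW (1, UnitaryGroup.rationalPairToAdelic (Fp L) L (IsCMField.complexConj L) N M (Matrix.diagonal dV) (Matrix.diagonal dW) g₀))⁻¹ =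
      iotaGG L e dV hdV dW hdW (1, UnitaryGroup.rationalPairToAdelic (Fp L) L (IsCMField.complexConj L) N M (Matrix.diagonal dV) (Matrix.diagonal dW) g₀) :=
  inv_eq_of_mul_eq_one_right (reflStd_mul_self L e dV hdV dW hdW hg₀)

include hg₀ in
/-- **the corner of `w₀ · q`, `q ∈ P_Δ(𝔸)`, is `−2·diag(0,1)·a_q`, of determinant `0`** (★ Part A `toBlocks₂₁_mul_siegel`).
[cite: GelbartPiatetskishapiroRallis1987, Part A §1] -/
theorem det_corner_reflStd_mul_siegel {q : HA L e dV hdV dW hdW} (hq : IsSiegelDelta L e dV hdV dW hdW q) :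
    ((Matrix.fromBlocks (1 : Matrix (Fin 2) (Fin 2) (AdeleRing (𝓞 L) L)) 0 (-1) 1 *
        blk L e dV hdV dW hdW (iotaGG L e dV hdV dW hdW
          (1, UnitaryGroup.rationalPairToAdelic (Fp L) L (IsCMField.complexConj L) N M (Matrix.diagonal dV) (Matrix.diagonal dW) g₀) * q) *
        Matrix.fromBlocks 1 0 1 1).toBlocks₂₁).det = 0 := by
  have hqf := fromBlocks_eq_of_toBlocks₂₁_eq_zero ((isSiegelDelta_iff_conj L e dV hdV dW hdW q).1 hq)
  rw [conj_blk_mul, frame_iotaGG_signInvolution L e dV hdV dW hdW (![0, 1] : Fin 2 → L) hg₀, hqf, toBlocks₂₁_mul_siegel, Matrix.det_mul,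
    algebraMap_pattern_std, det_neg_two_smul_diag01, zero_mul]

include hg₀ in
/-- **`w₀ · q ∉ P_Δ` for `q ∈ P_Δ(𝔸)`** (its corner `−2·diag(0,1)·a_q` has the entry `−2·(a_q)₁₁`-row non-zero; equivalently `w₀ ∉ P_Δ`).
[cite: GelbartPiatetskishapiroRallis1987, Part A §1] -/
theorem not_isSiegelDelta_reflStd_mul_siegel {q : HA L e dV hdV dW hdW} (hq : IsSiegelDelta L e dV hdV dW hdW q) :
    ¬ IsSiegelDelta L e dV hdV dW hdW (iotaGG L e dV hdV dW hdW
      (1, UnitaryGroup.rationalPairToAdelic (Fp L) L (IsCMField.complexConj L) N M (Matrix.diagonal dV) (Matrix.diagonal dW) g₀) * q) := by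
  intro h
  have hw : IsSiegelDelta L e dV hdV dW hdW (iotaGG L e dV hdV dW hdW
      (1, UnitaryGroup.rationalPairToAdelic (Fp L) L (IsCMField.complexConj L) N M (Matrix.diagonal dV) (Matrix.diagonal dW) g₀)) := by
    have h' := isSiegelDelta_mul L e dV hdV dW hdW h (isSiegelDelta_inv L e dV hdV dW hdW hq)
    rwa [mul_inv_cancel_right] at h'
  rw [isSiegelDelta_iff_conj, frame_iotaGG_signInvolution L e dV hdV dW hdW (![0, 1] : Fin 2 → L) hg₀, Matrix.toBlocks_fromBlocks₂₁,
    algebraMap_pattern_std, neg_eq_zero] at hw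
  have h11 : ((2 : AdeleRing (𝓞 L) L) • Matrix.diagonal (![0, 1] : Fin 2 → AdeleRing (𝓞 L) L)) 1 1 = 0 := by rw [hw]; rfl
  have h1 : (![0, 1] : Fin 2 → AdeleRing (𝓞 L) L) 1 = 1 := rfl
  rw [Matrix.smul_apply, Matrix.diagonal_apply_eq, h1, smul_eq_mul, mul_one] at h11
  haveI : Nontrivial (AdeleRing (𝓞 L) L) := inferInstanceAs (Nontrivial (InfiniteAdeleRing L × FiniteAdeleRing (𝓞 L) L))
  exact (isUnit_of_invertible (2 : AdeleRing (𝓞 L) L)).ne_zero h11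

variable (Λ : GL (Fin 2) (AdeleRing (𝓞 L) L) →* HA L e dV hdV dW hdW)
  (hΛ : ∀ g : GL (Fin 2) (AdeleRing (𝓞 L) L), blk L e dV hdV dW hdW (Λ g) =
    cayR (AdeleRing (𝓞 L) L) (Fin 2) * Matrix.fromBlocks (g : Matrix (Fin 2) (Fin 2) (AdeleRing (𝓞 L) L)) 0 0
      (((gramR L e dV hdV dW hdW).map ((algebraMap L (AdeleRing (𝓞 L) L)).comp (algebraMap (Fp L) L)))⁻¹ *
        (((g⁻¹ : GL (Fin 2) (AdeleRing (𝓞 L) L)) : Matrix (Fin 2) (Fin 2) (AdeleRing (𝓞 L) L)).map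
          (conjAdele (Fp L) L (IsCMField.complexConj L)))ᵀ *
        (gramR L e dV hdV dW hdW).map ((algebraMap L (AdeleRing (𝓞 L) L)).comp (algebraMap (Fp L) L))) *
      cayRinv (AdeleRing (𝓞 L) L) (Fin 2))

include hg₀ hΛ in
/-- **THE FRAME CRITERION** for `x ∈ GL₂(𝔸_L)` and `u ∈ N_Δ(𝔸)` with corner `X = (blk u)₁₂`:
`w₀ · (Λ x · u) · w₀ ∈ P_Δ(𝔸) ⟺ (x₁₀ = 0 ∧ (x♯)₀₁ = 0) ∧ (x · X)₁₁ = 0`, `x♯ = T⁻¹ (x̄⁻¹)ᵀ T` — ★ B2a `reflConj_leviFrame_mul_unip_siegel_iff`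
at `E = diag(0,1)` on the frames `W_E` (★ `frame_iotaGG_signInvolution`), `ℓ(x, x♯)` (α2c `frame_levi_apply`) and `n(X)` (★ `mem_unipDelta_iff_conj`).
[cite: MoeglinWaldspurger1995, II.1.7] [cite: GelbartPiatetskishapiroRallis1987, Part A §§1–2] -/
theorem isSiegelDelta_reflStd_conj_levi_unip_iff (x : GL (Fin 2) (AdeleRing (𝓞 L) L)) {u : HA L e dV hdV dW hdW} (hu : u ∈ unipDelta L e dV hdV dW hdW) :
    IsSiegelDelta L e dV hdV dW hdW
        (iotaGG L e dV hdV dW hdW (1, UnitaryGroup.rationalPairToAdelic (Fp L) L (IsCMField.complexConj L) N M (Matrix.diagonal dV) (Matrix.diagonal dW) g₀) *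
          (Λ x * u) *
          iotaGG L e dV hdV dW hdW (1, UnitaryGroup.rationalPairToAdelic (Fp L) L (IsCMField.complexConj L) N M (Matrix.diagonal dV) (Matrix.diagonal dW) g₀)) ↔
      (((x : Matrix (Fin 2) (Fin 2) (AdeleRing (𝓞 L) L)) 1 0 = 0 ∧
        (((gramR L e dV hdV dW hdW).map ((algebraMap L (AdeleRing (𝓞 L) L)).comp (algebraMap (Fp L) L)))⁻¹ *
          (((x⁻¹ : GL (Fin 2) (AdeleRing (𝓞 L) L)) : Matrix (Fin 2) (Fin 2) (AdeleRing (𝓞 L) L)).map (conjAdele (Fp L) L (IsCMField.complexConj L)))ᵀ *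
          (gramR L e dV hdV dW hdW).map ((algebraMap L (AdeleRing (𝓞 L) L)).comp (algebraMap (Fp L) L))) 0 1 = 0) ∧
      ((x : Matrix (Fin 2) (Fin 2) (AdeleRing (𝓞 L) L)) * (blk L e dV hdV dW hdW u).toBlocks₁₂) 1 1 = 0) := by
  obtain ⟨hE, -, -, -⟩ := cornerIdem_facts L e dV hdV dW hdW (pattern_std L)
  rw [isSiegelDelta_iff_conj, conj_blk_mul, conj_blk_mul, conj_blk_mul, frame_iotaGG_signInvolution L e dV hdV dW hdW (![0, 1] : Fin 2 → L) hg₀,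
    frame_levi_apply L e dV hdV dW hdW Λ hΛ x, (mem_unipDelta_iff_conj L e dV hdV dW hdW u).1 hu, reflConj_leviFrame_mul_unip_siegel_iff hE,
    algebraMap_pattern_std, diag01_mul_mul_one_sub_diag01_eq_zero_iff, one_sub_diag01_mul_mul_diag01_eq_zero_iff,
    Matrix.mul_assoc (Matrix.diagonal (![0, 1] : Fin 2 → AdeleRing (𝓞 L) L)) (x : Matrix (Fin 2) (Fin 2) (AdeleRing (𝓞 L) L)),
    diag01_mul_mul_diag01_eq_zero_iff]

include hg₀ hΛ in
/-- **THE RATIONAL FRAME CRITERION**: for `g ∈ GL₂(L)` and `u ∈ N_Δ(𝔸)`, `w₀ · (Λ ĝ · u) · w₀ ∈ P_Δ ⟺ g₁₀ = 0 ∧ (ĝ · X_u)₁₁ = 0` — for an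
upper-triangular `g` the co-block `ĝ♯ = T⁻¹(ḡ⁻¹)ᵀ T` (`T` diagonal) is lower triangular, so the `♯`-condition is automatic.
[cite: MoeglinWaldspurger1995, II.1.7] [cite: KudlaRallis1994, §2] -/
theorem isSiegelDelta_reflStd_conj_levi_map_unip_iff (g : GL (Fin 2) L) {u : HA L e dV hdV dW hdW}
    (hu : u ∈ unipDelta L e dV hdV dW hdW) :
    IsSiegelDelta L e dV hdV dW hdW
        (iotaGG L e dV hdV dW hdW (1, UnitaryGroup.rationalPairToAdelic (Fp L) L (IsCMField.complexConj L) N M (Matrix.diagonal dV) (Matrix.diagonal dW) g₀) *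
          (Λ (Matrix.GeneralLinearGroup.map (algebraMap L (AdeleRing (𝓞 L) L)) g) * u) *
          iotaGG L e dV hdV dW hdW (1, UnitaryGroup.rationalPairToAdelic (Fp L) L (IsCMField.complexConj L) N M (Matrix.diagonal dV) (Matrix.diagonal dW) g₀)) ↔
      (g : Matrix (Fin 2) (Fin 2) L) 1 0 = 0 ∧
        (((Matrix.GeneralLinearGroup.map (algebraMap L (AdeleRing (𝓞 L) L)) g : GL (Fin 2) (AdeleRing (𝓞 L) L)) : Matrix (Fin 2) (Fin 2) (AdeleRing (𝓞 L) L)) *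
          (blk L e dV hdV dW hdW u).toBlocks₁₂) 1 1 = 0 := by
  rw [isSiegelDelta_reflStd_conj_levi_unip_iff L e dV hdV dW hdW hg₀ Λ hΛ _ hu]
  have h10 : ((Matrix.GeneralLinearGroup.map (algebraMap L (AdeleRing (𝓞 L) L)) g : GL (Fin 2) (AdeleRing (𝓞 L) L)) :
      Matrix (Fin 2) (Fin 2) (AdeleRing (𝓞 L) L)) 1 0 = algebraMap L (AdeleRing (𝓞 L) L) ((g : Matrix (Fin 2) (Fin 2) L) 1 0) := rfl
  constructor
  · rintro ⟨⟨h1, -⟩, h2⟩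
    refine ⟨AdeleRing.algebraMap_injective (𝓞 L) L ?_, h2⟩
    rw [← h10, h1, map_zero]
  · rintro ⟨h1, h2⟩
    refine ⟨⟨by rw [h10, h1, map_zero], ?_⟩, h2⟩
    -- the `♯`-condition: `(T⁻¹ (ḡ⁻¹)ᵀ T)₀₁ = T₀⁻¹ · conj((g⁻¹)₁₀) · T₁ = 0`
    obtain ⟨t, ht⟩ := exists_gramR_eq_diagonal L e dV hdV dW hdW
    have hinv : (((Matrix.GeneralLinearGroup.map (algebraMap L (AdeleRing (𝓞 L) L)) g)⁻¹ : GL (Fin 2) (AdeleRing (𝓞 L) L)) :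
        Matrix (Fin 2) (Fin 2) (AdeleRing (𝓞 L) L)) 1 0 = 0 := by
      rw [← map_inv]
      show algebraMap L (AdeleRing (𝓞 L) L) (((g⁻¹ : GL (Fin 2) L) : Matrix (Fin 2) (Fin 2) L) 1 0) = 0
      rw [inv_apply_one_zero h1, map_zero]
    rw [ht, Matrix.diagonal_map (map_zero _), Matrix.inv_diagonal, Matrix.mul_diagonal, Matrix.diagonal_mul, Matrix.transpose_apply,
      Matrix.map_apply, hinv, map_zero, mul_zero, zero_mul]

include hg₀ hΛ in
/-- `u = 1`: **`w₀ · Λ ĝ · w₀ ∈ P_Δ ⟺ g ∈ B(L)`** (`g₁₀ = 0`) — the parabolic `B = M_Δ ∩ w₀⁻¹P_Δw₀` of the Levi is the upper Borel of `GL₂(L)`.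
[cite: MoeglinWaldspurger1995, II.1.7] [cite: KudlaRallis1994, §2] -/
theorem isSiegelDelta_reflStd_conj_levi_map_iff (g : GL (Fin 2) L) :
    IsSiegelDelta L e dV hdV dW hdW
        (iotaGG L e dV hdV dW hdW (1, UnitaryGroup.rationalPairToAdelic (Fp L) L (IsCMField.complexConj L) N M (Matrix.diagonal dV) (Matrix.diagonal dW) g₀) *
          Λ (Matrix.GeneralLinearGroup.map (algebraMap L (AdeleRing (𝓞 L) L)) g) *
          iotaGG L e dV hdV dW hdW (1, UnitaryGroup.rationalPairToAdelic (Fp L) L (IsCMField.complexConj L) N M (Matrix.diagonal dV) (Matrix.diagonal dW) g₀)) ↔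
      (g : Matrix (Fin 2) (Fin 2) L) 1 0 = 0 := by
  have h := isSiegelDelta_reflStd_conj_levi_map_unip_iff L e dV hdV dW hdW hg₀ Λ hΛ g (one_mem (unipDelta L e dV hdV dW hdW))
  rw [mul_one, blk_one, ← Matrix.fromBlocks_one, Matrix.toBlocks_fromBlocks₁₂, Matrix.mul_zero, Matrix.zero_apply] at h
  rw [h]
  exact ⟨fun h' => h'.1, fun h' => ⟨h', rfl⟩⟩

end Doubled

end Summit.HodgeConjecture.HodgeConjecture.Cruxes.HLiu418.K2LiuSiegelMiddleCellLeviCriterion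

end
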